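import Literature.NumberTheory.GelbartRogawski1991.LocalDoubledUnitaryDatum
import Literature.NumberTheory.GelbartRogawski1991.LocalLeraySection
import Literature.RepresentationTheory.HeisenbergGroup.SchrodingerLeraySectionSmooth
import Literature.NumberTheory.Automorphic.GLnCongruenceSubgroups
import Literature.NumberTheory.Automorphic.UnitaryGroupSplitPlace
import Literature.NumberTheory.Automorphic.UnitaryGroupNonsplitPlace
import HarnessLib

/-!
# Smoothness of the Leray-normalised section along the stabiliser of its Lagrangian in `U(J)(F_v)` (GR-1's `L6a`)

Topic `NumberTheory/GelbartRogawski1991`; namespace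
`Literature.NumberTheory.GelbartRogawski1991.UnitaryDualPair.LocalSplitting` (the namespace of the INTERFACE file
`LocalUnitarySplittingDatum.lean`). KERNEL ONLY: theorems; no definition, no named fact, no `sorry`.

Setting: `E/F` quadratic, `c`, `δ` (`c δ = -δ ≠ 0`), an `F`-rational symmetric `T ∈ GL_N(F)`, `J = T ⊗ 1`, a finite
place `v` of `F`, the local Schrödinger model `localSchrodinger F N T v` on `𝒮(F_vᴺ)` and the embedding
`ι_v = iota : U(J)(F_v) →* Sp(𝕎_v)` of the interface file. For a Lagrangian `ℓ` of `𝕎_v` let `r` be THE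
normalised section of implementers whose multiplier is the Leray cocycle `c^{ψ_v(½·)}_ℓ` (the `L0` input,
`exists_leraySection_half`; Rao's Theorem 4.1 (5)). This file proves, for every `Φ ∈ 𝒮(F_vᴺ)` and every place
`w ∣ v` of `E`:

* `continuous_iota_apply`, `continuous_coe_iota` — `p ↦ ι_v(p) x` is continuous on `U(J)(F_v)` (topology of the
  closed subgroup of `Π_{w ∣ v} GL_N(E_w)`), i.e. `p ↦ ⇑ι_v(p)` is continuous for the product topology on `𝕎_v → 𝕎_v`
  ([MoeglinVignerasWaldspurger1987] Chap. 1 I.17: `ι` is a morphism of algebraic groups over `F_v`);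
* `exists_congruenceGL_forall_mem` — **every neighbourhood of `1` in `U(J)(F_v)` contains
  `{p : p_w ∈ K_γ}` for some level `γ ≠ 0`**, `K_γ ≤ GL_N(E_w)` the principal congruence subgroup of the tree's
  `GLnCongruenceSubgroups` (non-split `v`: `w` is the only place above `v`; split `v`: the projection
  `U(J)(F_v) ≃ₜ* GL_N(E_w)`, tree `localPiSplitEquiv`);
* **`exists_congruenceGL_forall_parabolic_apply_eq_self`** (GR-1's `L6a`, [MoeglinVignerasWaldspurger1987] Chap. 2
  II.6, II.8): there is `γ ≠ 0` with `r(ι_v p) Φ = Φ` for every `p ∈ U(J)(F_v)` such that `ι_v(p) ℓ = ℓ` and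
  `p_w ∈ K_γ` — from the symplectic statement `HeisenbergGroup.exists_nhds_forall_parabolic_apply_eq_self_gram`;
* `exists_congruenceGL_forall_siegelDelta_apply_eq_self` — the same for the doubled datum (`gramD`, `iotaD`,
  `deltaLagrangian`, `IsSiegelDelta` of `LocalDoubledUnitaryDatum`), in the binder order of GR-1's skeleton stub
  `stub_L6a_parabolicSmooth` (v4.5), with the character pinned to `ψ_v(½·)` and the level asserted `≠ 0` (an
  assertion `γ < 1` alone would be vacuous at `γ = 0`);
* `exists_leraySection_half_smooth` — `L0 ∧ L6a` bundled: a section `r` normalised at `ψ_v(½·)` together with its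
  parabolic smoothness at every `w ∣ v`.

Written for the kernel construction of the cited input `hGRU` ([GelbartRogawski1991, Prop. 3.1.1]) of the Hodge-CM
period-theorem package (stage-1 cell `pub-hodgecm`, seat GR-1's local skeleton, stub `L6a`). Nothing in this file is
a claim of the manuscripts adjudicated by that cell.

## References

* C. Mœglin, M.-F. Vignéras, J.-L. Waldspurger, LNM 1291 (1987), Chap. 1 I.17, Chap. 2 II.6, II.8
  [MoeglinVignerasWaldspurger1987].
* R. Ranga Rao, Pacific J. Math. 157 (1993) 335–371, Thm 3.5, Thm 4.1 (5) [Rangarao1993].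
* S. Gelbart, J. Rogawski, Invent. Math. 105 (1991), §3.1 Prop. 3.1.1, p. 455 [GelbartRogawski1991].
* V. Platonov, A. Rapinchuk, *Algebraic Groups and Number Theory* (1994), §3.3, §5.1 (congruence subgroups as a
  neighbourhood basis) [PlatonovRapinchuk1994].
-/

set_option autoImplicit false

noncomputable section

open NumberField IsDedekindDomain MeasureTheory Matrix Topology Filter
open Literature.RepresentationTheory.HeisenbergGroup
open Literature.NumberTheory.Automorphic Literature.NumberTheory.Automorphic.UnitaryGroup Literature.NumberTheory.Weil1964
open Literature.NumberTheory.GaloisRepresentations.IsNonarchimedeanLocalField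

namespace Literature.NumberTheory.GelbartRogawski1991.UnitaryDualPair.LocalSplitting

variable (F : Type) [Field F] [NumberField F] (E : Type) [Field E] [NumberField E] [Algebra F E]
  [Algebra.IsQuadraticExtension F E] (c : E ≃ₐ[F] E) (N : ℕ)
  {δ : E} (hcδ : c δ = -δ) (hδ : δ ≠ 0) {d : F} (hd : δ * δ = algebraMap F E d)
  (T : Matrix (Fin N) (Fin N) F) (hT : T.IsSymm) (hTd : IsUnit T.det)
  {J : Matrix (Fin N) (Fin N) E} (hJ : J = T.map (algebraMap F E))
  (v : HeightOneSpectrum (𝓞 F))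

/-! ## §1 `p ↦ ι_v(p) x` is continuous -/

/-- **`p ↦ ι_v(p) x` is continuous on `U(J)(F_v)`** for every `x ∈ 𝕎_v = F_vᴺ × F_vᴺ`: in the coordinates
`𝕎_v = reIm ((E ⊗ F_v)ᴺ)`, `ι_v(p) (reIm y) = reIm (p y)` (`localToSymplectic_reIm`) and `re`, `im`, matrix
multiplication are continuous. [cite: MoeglinVignerasWaldspurger1987, Chap. 1 I.17] -/
theorem continuous_iota_apply (x : (Fin N → v.adicCompletion F) × (Fin N → v.adicCompletion F)) :
    Continuous fun p : UnitaryGroup.localPi E c N J v =>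
      ((iota F E c N hcδ hδ hd T hT hJ v p : LocalSp F N T v) :
        ((Fin N → v.adicCompletion F) × (Fin N → v.adicCompletion F)) ≃ₗ[v.adicCompletion F]
          ((Fin N → v.adicCompletion F) × (Fin N → v.adicCompletion F))) x := by
  set Ψ := (quadraticLocalEquiv E v c hcδ hδ).toLinearEquiv.toAddEquiv with hΨ_def
  have hΨ : Continuous Ψ.symm := (quadraticLocalEquiv E v c hcδ hδ).symm.continuous
  have hre := QuadraticCoordinates.continuous_re Ψ hΨ
  have him := QuadraticCoordinates.continuous_im Ψ hΨ
  set y := (QuadraticCoordinates.reIm Ψ (Fin N)).symm x with hy_def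
  have hx : x = QuadraticCoordinates.reIm Ψ (Fin N) y := ((QuadraticCoordinates.reIm Ψ (Fin N)).apply_symm_apply x).symm
  -- the matrix of `p` as an element of `GL_N(E ⊗ F_v)`, a continuous function of `p`
  have hg : Continuous fun p : UnitaryGroup.localPi E c N J v =>
      ((UnitaryGroup.localPiEquiv E c N J v p).1.1 : Matrix (Fin N) (Fin N) (UnitaryGroup.LocalRing E v)) :=
    Units.continuous_val.comp (continuous_subtype_val.comp (UnitaryGroup.localPiEquiv E c N J v).continuous)
  have hmv : Continuous fun p : UnitaryGroup.localPi E c N J v =>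
      ((UnitaryGroup.localPiEquiv E c N J v p).1.1 : Matrix (Fin N) (Fin N) (UnitaryGroup.LocalRing E v)) *ᵥ y :=
    hg.matrix_mulVec continuous_const
  have hformula : ∀ p : UnitaryGroup.localPi E c N J v,
      ((iota F E c N hcδ hδ hd T hT hJ v p : LocalSp F N T v) :
        ((Fin N → v.adicCompletion F) × (Fin N → v.adicCompletion F)) ≃ₗ[v.adicCompletion F]
          ((Fin N → v.adicCompletion F) × (Fin N → v.adicCompletion F))) x =
      QuadraticCoordinates.reIm Ψ (Fin N)
        (((UnitaryGroup.localPiEquiv E c N J v p).1.1 : Matrix (Fin N) (Fin N) (UnitaryGroup.LocalRing E v)) *ᵥ y) := by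
    intro p
    rw [hx, iota_def]
    exact UnitaryGroup.localToSymplectic_reIm E c N v hcδ hδ hd hT hJ (UnitaryGroup.localPiEquiv E c N J v p) y
  simp_rw [hformula]
  exact Continuous.prodMk (continuous_pi fun i => hre.comp ((continuous_apply i).comp hmv))
    (continuous_pi fun i => him.comp ((continuous_apply i).comp hmv))

/-- **`p ↦ ⇑ι_v(p)` is continuous for the product topology on `𝕎_v → 𝕎_v`**. [cite: MoeglinVignerasWaldspurger1987, Chap. 1 I.17] -/
theorem continuous_coe_iota :
    Continuous fun p : UnitaryGroup.localPi E c N J v =>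
      (⇑((iota F E c N hcδ hδ hd T hT hJ v p : LocalSp F N T v) :
        ((Fin N → v.adicCompletion F) × (Fin N → v.adicCompletion F)) ≃ₗ[v.adicCompletion F]
          ((Fin N → v.adicCompletion F) × (Fin N → v.adicCompletion F))) :
        ((Fin N → v.adicCompletion F) × (Fin N → v.adicCompletion F)) →
          ((Fin N → v.adicCompletion F) × (Fin N → v.adicCompletion F))) :=
  continuous_pi fun x => continuous_iota_apply F E c N hcδ hδ hd T hT hJ v x

/-! ## §2 Congruence neighbourhoods of `1` in `U(J)(F_v)` -/

include hT hJ in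
omit [NumberField F] [NumberField E] [Algebra.IsQuadraticExtension F E] in
/-- `J = T ⊗ 1` is hermitian: `(c J)ᵀ = J` (`T` symmetric with entries in `F`). [cite: GelbartRogawski1991, §3.1 p. 454] -/
theorem transpose_map_galConj_eq : (J.map c)ᵀ = J := by
  rw [hJ, Matrix.map_map]
  have h : (⇑c ∘ ⇑(algebraMap F E)) = ⇑(algebraMap F E) := funext fun t => c.commutes t
  rw [h, ← Matrix.transpose_map, hT.eq]

include hTd hJ in
omit [NumberField F] [NumberField E] [Algebra.IsQuadraticExtension F E] in
/-- `J = T ⊗ 1` is invertible (`det T` a unit). [cite: GelbartRogawski1991, §3.1 p. 454] -/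
theorem isUnit_form : IsUnit J := by
  rw [Matrix.isUnit_iff_isUnit_det, hJ]
  exact UnitaryGroup.isUnit_det_map (algebraMap F E) hTd

include hcδ hδ in
omit [NumberField F] [Algebra.IsQuadraticExtension F E] in
/-- `c ≠ 1` (it negates `δ ≠ 0`). [folklore] -/
private theorem galConj_ne_one : c ≠ 1 := by
  rintro rfl
  rw [AlgEquiv.one_apply] at hcδ
  exact hδ (self_eq_neg.1 hcδ)

include hcδ hδ hT hTd hJ in
/-- **every neighbourhood of `1` in `U(J)(F_v)` contains a congruence neighbourhood at `w`**: for `U ∈ 𝓝 1` there is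
a level `γ ≠ 0` with `{p ∈ U(J)(F_v) : p_w ∈ K_γ} ⊆ U`, `K_γ = congruenceGL N γ ≤ GL_N(E_w)`.  At a non-split place
`w` is the only place above `v` and `U(J)(F_v) ≤ GL_N(E_w)` carries the subspace topology; at a split place the
projection `p ↦ p_w` is an isomorphism of topological groups `U(J)(F_v) ≃ₜ* GL_N(E_w)` (tree `localPiSplitEquiv`);
in `GL_N(E_w)` the principal congruence subgroups form a neighbourhood basis of `1` (tree `exists_congruenceGL_subset`).
[cite: PlatonovRapinchuk1994, §3.3 and §5.1] -/
theorem exists_congruenceGL_forall_mem (w : UnitaryGroup.PlacesOver E v) {U : Set (UnitaryGroup.localPi E c N J v)}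
    (hU : U ∈ 𝓝 (1 : UnitaryGroup.localPi E c N J v)) :
    ∃ γ : ValuativeRel.ValueGroupWithZero (w.1.adicCompletion E), γ ≠ 0 ∧
      ∀ p : UnitaryGroup.localPi E c N J v,
        (p : UnitaryGroup.LocalGLPi E N v) w ∈ congruenceGL N γ → p ∈ U := by
  have hc : c ≠ 1 := galConj_ne_one F E c hcδ hδ
  by_cases hw : c • w.1 = w.1
  · -- non-split: `w` is the only place above `v`
    haveI := UnitaryGroup.PlacesOver.subsingleton_of_smul_eq c hc w hw
    obtain ⟨t, ht, htU⟩ := (mem_nhds_subtype _ _ _).1 hU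
    rw [nhds_pi] at ht
    obtain ⟨I, -, s, hs, hst⟩ := Filter.mem_pi.1 ht
    obtain ⟨γ, hγ⟩ := exists_congruenceGL_subset (hs w)
    refine ⟨γ, γ.ne_zero, fun p hp => htU (hst (Set.mem_pi.2 fun w' _ => ?_))⟩
    obtain rfl : w' = w := Subsingleton.elim w' w
    exact hγ hp
  · -- split: `p ↦ p_w` is a homeomorphism onto `GL_N(E_w)`
    set e := UnitaryGroup.localPiSplitEquiv c J hc (transpose_map_galConj_eq F E c N T hT hJ) w hw
      (UnitaryGroup.isUnit_placeForm J (isUnit_form F E N T hTd hJ) w.1) with he_def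
    have h1 : (⇑e.symm) ⁻¹' U ∈ 𝓝 (1 : GL (Fin N) (w.1.adicCompletion E)) := by
      refine e.symm.continuous.continuousAt.preimage_mem_nhds ?_
      have he1 : e.symm 1 = 1 := map_one e.symm
      change U ∈ 𝓝 (e.symm 1)
      rw [he1]
      exact hU
    obtain ⟨γ, hγ⟩ := exists_congruenceGL_subset h1
    refine ⟨γ, γ.ne_zero, fun p hp => ?_⟩
    have h := hγ hp
    rw [Set.mem_preimage] at h
    have hpw : (p : UnitaryGroup.LocalGLPi E N v) w = e p := rfl
    rwa [hpw, ContinuousMulEquiv.symm_apply_apply] at h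

/-! ## §3 `L6a`: parabolic smoothness of the Leray-normalised section along `ι_v(P_ℓ)` -/

variable [MeasurableSpace (v.adicCompletion F)] [BorelSpace (v.adicCompletion F)]
  (μ : Measure (v.adicCompletion F)) [μ.IsAddHaarMeasure]

include hcδ hδ in
/-- **L6a — PARABOLIC SMOOTHNESS OF THE LERAY-NORMALISED SECTION ALONG `ι_v`**: let `ℓ` be a Lagrangian of `𝕎_v`
and `r` the normalised section of implementers of `localSchrodinger F N T v` whose multiplier is the Leray cocycle
`c^{ψ_v(½·)}_ℓ` (the `L0` section).  For every `Φ ∈ 𝒮(F_vᴺ)` and every `w ∣ v` there is a level `γ ≠ 0` such that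
`r(ι_v p) Φ = Φ` for all `p ∈ U(J)(F_v)` with `ι_v(p) ℓ = ℓ` and `p_w ∈ K_γ`.
[cite: MoeglinVignerasWaldspurger1987, Chap. 2 II.6, II.8; Rangarao1993, Thm 3.5, Thm 4.1 (5)] -/
theorem exists_congruenceGL_forall_parabolic_apply_eq_self (w : UnitaryGroup.PlacesOver E v)
    (ℓ : Submodule (v.adicCompletion F) ((Fin N → v.adicCompletion F) × (Fin N → v.adicCompletion F)))
    (hℓ : LinearMap.BilinForm.orthogonal (alt (polar (localPairing F N T v))) ℓ = ℓ)
    (hU : ImplementerUniqueUpToScalar (localSchrodinger F N T v)) (r : ImplementerSection (localSchrodinger F N T v))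
    (hr : ∀ g₁ g₂ : LocalSp F N T v, r.cocycle hU g₁ g₂ =
      localLeray F N T hTd v μ ((adeleAddCharAt F v).mulShift (⅟(2 : v.adicCompletion F)))
        (isContinuousNontrivial_adeleAddCharAt_half F v) ℓ hℓ g₁ g₂)
    (Φ : SchwartzBruhat (Fin N → v.adicCompletion F)) :
    ∃ γ : ValuativeRel.ValueGroupWithZero (w.1.adicCompletion E), γ ≠ 0 ∧
      ∀ p : UnitaryGroup.localPi E c N J v,
        ℓ.map (toLin F v (iota F E c N hcδ hδ hd T hT hJ v p)) = ℓ →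
        (p : UnitaryGroup.LocalGLPi E N v) w ∈ congruenceGL N γ →
        r (iota F E c N hcδ hδ hd T hT hJ v p) Φ = Φ := by
  haveI : CharZero (v.adicCompletion F) :=
    charZero_of_injective_algebraMap (algebraMap F (v.adicCompletion F)).injective
  have hTv : IsUnit (localGram F N T v).det := UnitaryGroup.isUnit_det_map (algebraMap F (v.adicCompletion F)) hTd
  -- the symplectic statement: a neighbourhood `V` of `id` in `𝕎_v → 𝕎_v`
  obtain ⟨V, hV, hfix⟩ := exists_nhds_forall_parabolic_apply_eq_self_gram (localGram F N T v) hTv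
    (isLocallyConstant_of_isContinuousNontrivial (isContinuousNontrivial_adeleAddCharAt F v))
    (fun y => by
      simp only [Matrix.toLinearMap₂'_apply', dotProduct]
      exact continuous_finsetSum _ fun i _ => (continuous_apply i).mul continuous_const)
    μ (isContinuousNontrivial_adeleAddCharAt F v) hU r hℓ
    (Literature.GroupTheory.CentralCocycle.ext fun g₁ g₂ => hr g₁ g₂) Φ
  -- pulled back along the continuous `p ↦ ⇑ι_v(p)` it is a neighbourhood of `1` in `U(J)(F_v)`
  have hV' : (fun p : UnitaryGroup.localPi E c N J v =>
      (⇑((iota F E c N hcδ hδ hd T hT hJ v p : LocalSp F N T v) :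
        ((Fin N → v.adicCompletion F) × (Fin N → v.adicCompletion F)) ≃ₗ[v.adicCompletion F]
          ((Fin N → v.adicCompletion F) × (Fin N → v.adicCompletion F))) :
        ((Fin N → v.adicCompletion F) × (Fin N → v.adicCompletion F)) →
          ((Fin N → v.adicCompletion F) × (Fin N → v.adicCompletion F)))) ⁻¹' V ∈
      𝓝 (1 : UnitaryGroup.localPi E c N J v) := by
    refine (continuous_coe_iota F E c N hcδ hδ hd T hT hJ v).continuousAt.preimage_mem_nhds ?_
    rwa [map_one, Subgroup.coe_one, LinearEquiv.coe_one]
  obtain ⟨γ, hγ0, hγ⟩ := exists_congruenceGL_forall_mem F E c N hcδ hδ T hT hTd hJ v w hV'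
  exact ⟨γ, hγ0, fun p hp hpw => hfix _ hp (hγ p hpw)⟩

/-! ## §4 The doubled datum: GR-1's `stub_L6a_parabolicSmooth` -/

section Doubled

variable (n : ℕ) {T₀ : Matrix (Fin n) (Fin n) F} (hT₀ : T₀.IsSymm) (hT₀d : IsUnit T₀.det)
  {JD : Matrix (Fin (n + n)) (Fin (n + n)) E} (hJD : JD = (gramD F n T₀).map (algebraMap F E))

include hcδ hδ in
/-- **GR-1's `L6a` for the doubled quasi-split datum `U(𝕍 ⊕ −𝕍)`** (binder order of the skeleton stub
`stub_L6a_parabolicSmooth`, v4.5): for the `L0` section `r` of `localSchrodinger F (n+n) (gramD F n T₀) v`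
(multiplier `c^{ψ_v(½·)}_{ℓ_Δ}`, `ℓ_Δ = deltaLagrangian`) and every `Φ`, there is a level `γ ≠ 0` at `w ∣ v` with
`r(ι^𝔻_v p) Φ = Φ` for all `p ∈ P_Δ(F_v)` (`IsSiegelDelta`) whose `w`-component lies in `congruenceGL (n+n) γ`.
[cite: MoeglinVignerasWaldspurger1987, Chap. 2 II.6, II.8; Rangarao1993, Thm 4.1 (5)] -/
theorem exists_congruenceGL_forall_siegelDelta_apply_eq_self (w : UnitaryGroup.PlacesOver E v)
    (hU : ImplementerUniqueUpToScalar (localSchrodinger F (n + n) (gramD F n T₀) v))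
    (r : ImplementerSection (localSchrodinger F (n + n) (gramD F n T₀) v))
    (hr : ∀ g₁ g₂ : LocalSp F (n + n) (gramD F n T₀) v, r.cocycle hU g₁ g₂ =
      localLeray F (n + n) (gramD F n T₀) (isUnit_det_gramD F n hT₀d) v μ
        ((adeleAddCharAt F v).mulShift (⅟(2 : v.adicCompletion F))) (isContinuousNontrivial_adeleAddCharAt_half F v)
        (deltaLagrangian F v n) (deltaLagrangian_orthogonal F v n T₀ hT₀d) g₁ g₂)
    (Φ : SchwartzBruhat (Fin (n + n) → v.adicCompletion F)) :
    ∃ γ : ValuativeRel.ValueGroupWithZero (w.1.adicCompletion E), γ ≠ 0 ∧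
      ∀ p : UnitaryGroup.localPi E c (n + n) JD v, IsSiegelDelta F E c hcδ hδ hd v n hT₀ hJD p →
        ((p : UnitaryGroup.LocalGLPi E (n + n) v) w ∈ congruenceGL (n + n) γ) →
        r (iotaD F E c hcδ hδ hd v n hT₀ hJD p) Φ = Φ :=
  exists_congruenceGL_forall_parabolic_apply_eq_self F E c (n + n) hcδ hδ hd (gramD F n T₀) (gramD_isSymm F n hT₀)
    (isUnit_det_gramD F n hT₀d) hJD v μ w (deltaLagrangian F v n) (deltaLagrangian_orthogonal F v n T₀ hT₀d) hU r hr Φ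

end Doubled

/-! ## §5 `L0 ∧ L6a` bundled -/

include hcδ hδ in
/-- **the `L0` section together with its parabolic smoothness**: for every Lagrangian `ℓ` of `𝕎_v` there are `hU`
and a normalised implementer section `r` of `localSchrodinger F N T v` with multiplier `c^{ψ_v(½·)}_ℓ`
([Rangarao1993, Thm 4.1 (5)], tree `exists_leraySection_half`) such that, for every `w ∣ v` and every `Φ`, some
level `γ ≠ 0` at `w` has `r(ι_v p) Φ = Φ` for all `p` with `ι_v(p) ℓ = ℓ`, `p_w ∈ K_γ`.
[cite: Rangarao1993, Thm 4.1 (5), p. 358; MoeglinVignerasWaldspurger1987, Chap. 2 II.6, II.8] -/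
theorem exists_leraySection_half_smooth
    (ℓ : Submodule (v.adicCompletion F) ((Fin N → v.adicCompletion F) × (Fin N → v.adicCompletion F)))
    (hℓ : LinearMap.BilinForm.orthogonal (alt (polar (localPairing F N T v))) ℓ = ℓ) :
    ∃ (hU : ImplementerUniqueUpToScalar (localSchrodinger F N T v)) (r : ImplementerSection (localSchrodinger F N T v)),
      (∀ g₁ g₂ : LocalSp F N T v, r.cocycle hU g₁ g₂ =
        localLeray F N T hTd v μ ((adeleAddCharAt F v).mulShift (⅟(2 : v.adicCompletion F)))
          (isContinuousNontrivial_adeleAddCharAt_half F v) ℓ hℓ g₁ g₂) ∧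
      ∀ (w : UnitaryGroup.PlacesOver E v) (Φ : SchwartzBruhat (Fin N → v.adicCompletion F)),
        ∃ γ : ValuativeRel.ValueGroupWithZero (w.1.adicCompletion E), γ ≠ 0 ∧
          ∀ p : UnitaryGroup.localPi E c N J v,
            ℓ.map (toLin F v (iota F E c N hcδ hδ hd T hT hJ v p)) = ℓ →
            (p : UnitaryGroup.LocalGLPi E N v) w ∈ congruenceGL N γ →
            r (iota F E c N hcδ hδ hd T hT hJ v p) Φ = Φ := by
  obtain ⟨hU, r, hr⟩ := exists_leraySection_half F N T hTd v μ ℓ hℓ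
  exact ⟨hU, r, hr, fun w Φ =>
    exists_congruenceGL_forall_parabolic_apply_eq_self F E c N hcδ hδ hd T hT hTd hJ v μ w ℓ hℓ hU r hr Φ⟩

end Literature.NumberTheory.GelbartRogawski1991.UnitaryDualPair.LocalSplitting

end
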